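import Summits.QuantumFields.YangMills.Theorems.BalabanUVNodesN21ChartExponentAnalyticU1Local
import Summits.QuantumFields.YangMills.Theorems.BalabanUVNodesN21ChartExponentCoercivity

/-!
# N21 (NE7c) · THE `U(1)` LINEAGE IN TREE GAUGE: the (1.9) binder `h19` DISCHARGED for the abelian second-order member
# (dag-n21-w3 g4's ★ `ineq19_of_ineq17_treeGauge` FED BY NAME), the exact chart expansion of the block action, and ★★★
# «the scaled abelian Wilson action of a cube in the comb tree gauge is CONVEX on the window for g small»

Width seat pub-ymgap-dag-n21-w5 (g2; director-ym R399 (3a) ∕ №209 second wave, dag-lead WIDTH-209), node N21 = NE7c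
(single-run shell-weight bound, NOT PRINTED in [Bałaban 1983–89], NOT proved), lane K3⁷ `SpineGivenEndpointR13SepCoPH`
(stmt-QuantumFields-20544, `--kind proof --supports … --as helper`).  Located hand «P2-U1B» of WIDTH-209 N21 piece 2 (pen
dag-n21-w3 g4, bus I.34578; this seat's CLAIM-2 ∕ INTENT-6 I.34620), file 6 of this seat's `U(1)` model-instance lineage
(p606810 · p607837 · p610142 · p612065 · p614863).

THE POINT.  Every file of the lineage displayed the coercivity of the exponent's quadratic member as the (1.9) row
`h19 : ∀ v, Ineq19 (v ⬝ᵥ (A *ᵥ v)) (Σ_b v_b²) γ₀ d M` for an ABSTRACT matrix `A`.  For the abelian block action the quadratic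
member is not abstract: `B16Txt357ThirdOrderU1.V12` subtracts exactly `g²∕2·Σ_p ζ_p φ_p² cos θ_p`, i.e. `A = Hᵀ·diag(ζ cos θ)·H`
for the chart matrix `H` (`φ = H *ᵥ v`, print's `∂H_{1,k}B′`).  When `H` IS the plaquette curl of a tree-gauge-fixed cube chart
(dag-n21-w3 g4's frame of p616546: chart coordinates `κ`, extension `E` to bond configurations on `Λ = block n y`
vanishing on the comb tree `G₀` and preserving `Σ²`, `1 ≤ n ≤ 100M`) and the background is nearly flat
(`ζ_p cos θ_p ≥ γ₀ ≥ 0`), print's (1.7) row holds with NO correction and the Literature's PROVED cube Poincaré inequality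
(1.8) turns it into (1.9) — dag-n21-w3 g4's ★ `N21ChartExponentCoercivity.ineq19_of_ineq17_treeGauge`.  Hence:
* §1 [textbook] `dotProduct_transpose_diagonal_mulVec` (`v ⬝ᵥ ((Hᵀ·diag w·H) *ᵥ v) = Σ_q w_q (Hv)_q²`) and
  `actionU1_chart_expansion` — the EXACT expansion `g⁻²·A(ζ, θ + g·Hv) = g⁻²·A(ζ, θ) + g⁻¹·Σ_q ζ_q (Hv)_q sin θ_q
  + ½·v ⬝ᵥ ((Hᵀ·diag(ζ cos θ)·H) *ᵥ v) + g⁻²·V12 g ζ θ (Hv)` (`V12`'s definition read backwards): the lineage's `hexp` binder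
  DISCHARGED for `φ :=` the genuine action; `linMemberU1_apply` bundles the (1.5)-type linear member;
* §2 ★ `ineq19_U1_treeGauge`: the ENDs' `h19` AS A THEOREM for `A = Hᵀ·diag(ζ cos θ)·H` on any tree-gauge frame with the
  located identification `hcurl : (H *ᵥ v)_q = (∂ E v)(q)`;
* §3 ★★ `convexOn_chartExponentU1_treeGauge` (this seat's p614863 ★★★-loc with `h19` DISCHARGED) and ★★★
  `convexOn_actionU1_treeGaugeChart`: the scaled abelian block action `v ↦ g⁻²·Σ_q ζ_q(1 − cos(θ_q + g(Hv)_q))` ITSELF is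
  CONVEX on any convex window `|(Hv)_q| ≤ Φ` under the letters `γ₀ ≤ ζ cos θ`, `Σ_i |H_{qi}| ≤ c_H`, `Σ ζ ≤ Z` and the ONE
  analytic clause `4·d·(100M)^{d+1}·g(Φ + c_H r)³e^{g(Φ + c_H r)}Z ≤ γ₀·r²` (any `r > 0`) — no expansion, coercivity,
  second-order or diameter hypothesis left;
* §4 A6 (№189 (3)) `actionU1_treeGauge_letters_inhabited`: on dag-n21-w3 g4's §1 off-tree frame
  `κ = ↥(innerBonds n y ∖ treeBonds n y) × Fin 1` of ANY cube (`1 ≤ n ≤ 100M`, `1 ≤ d`) with `E :=` extension by zero and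
  `H :=` the curl matrix of the basis extensions — `hcurl` (`mulVec_curlMatrix`) and the row-sum letter `≤ 4`
  (`rowSum_curlMatrix_le_four`) PROVED — flat background, `ζ = 1`, window `B̄₁(0)`, `r = 1`,
  `g = 1∕(2¹³·d·(100M)^{d+1}·(#plaquettes + 1))`: EVERY binder of ★★★ discharged — the abelian Wilson action of the cube in
  the comb tree gauge is CONVEX on the unit window at that coupling, a closed theorem.

HONEST FRAMING.  MODEL-level: the abelian lattice action (`U(1)`, 𝔤 = ℝ, or `Fin D` copies of it), flat-ish background
letter `ζ cos θ ≥ γ₀`; [textbook]∕[folklore] algebra + composition BY NAME (p616546 ★, p614863 ★★★-loc, lit-balaban's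
`B16Txt357ThirdOrderU1`, `B6TreeGaugePoincare`); nothing of Bałaban's `SU(N)` objects — (1.7) for `Δ₁(ζ₀)` stays NODE O's
term object, (1.8) is the Literature's PROVED CUBE theorem (rectangular parallelepipeds are its TODO); the identifications
(`H = ∂H_{1,k}` ↔ curl of the tree-gauge chart, `ζ₀`, `θ`, the window, `r`) are LOCATED typing, NOT asserted; (M1) ∕ NE7c
NOT PRINTED ∕ NOT proved; N21 NOT discharged; K3⁷ NOT claimed; counts unmoved (typed 28∕28 · discharged 5∕28, work-bound
face 5∕27); count-neutral; one finite 𝕋⁴ at fixed ε — R4 would close only the conditional finite-𝕋⁴ rung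
`BalabanLadder.UV`, NOT the Yang–Mills mass gap (Clay); nothing about ℝ⁴ ∕ OS.  THEOREMS ONLY: 0 `def`, 0 `sorry`.
-/

set_option autoImplicit false

open Real Finset Set Matrix Metric

namespace Summit.QuantumFields.YangMills.Theorems.N21ChartExponentU1TreeGaugeCoercive

open Literature.MathematicalPhysics.QuantumFieldTheory.Balaban1983to89
open Literature.MathematicalPhysics.QuantumFieldTheory.Balaban1983to89.B16Txt357ThirdOrderU1 (actionU1 V12)
open Literature.MathematicalPhysics.QuantumFieldTheory.Balaban1983to89.B16Sect1Wilson (Ineq17 Ineq19)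
open Literature.MathematicalPhysics.QuantumFieldTheory.Balaban1983to89.B6TreeGaugePoincare
  (Cfg curl innerBonds innerPlaq treeBonds_subset_innerBonds)
open Literature.MathematicalPhysics.QuantumFieldTheory.Balaban1983to89.B6BondElimination (treeBonds)
open Summit.QuantumFields.YangMills.Theorems.N21ChartExponentAnalyticU1Local (convexOn_chartExponentU1_analytic_local)
open Summit.QuantumFields.YangMills.Theorems.N21ChartExponentCoercivity
  (ineq19_of_ineq17_treeGauge extendOffTree_tree sum_sq_extendOffTree)

/-! ## §1  The abelian second-order member as a matrix, and the EXACT chart expansion of the block action -/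

section Algebra

variable {κ : Type*} [Fintype κ] {ι : Type*} [Fintype ι]

/-- **THE ABELIAN SECOND-ORDER MEMBER AS A MATRIX**: `v ⬝ᵥ ((Hᵀ·diag(w)·H) *ᵥ v) = Σ_q w_q·((H *ᵥ v)_q)²`.  With
`w_q = ζ_q cos θ_q` this is twice the `g²∕2·Σ_p ζ_p φ_p² cos θ_p` member that `B16Txt357ThirdOrderU1.V12` subtracts — print's
*"leading quadratic form ⟨H_{1,k}B′, Δ₁(ζ₀)H_{1,k}B′⟩"* of (1.2) in the abelian model. [textbook] -/
theorem dotProduct_transpose_diagonal_mulVec [DecidableEq ι] (H : Matrix ι κ ℝ) (w : ι → ℝ) (v : κ → ℝ) :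
    v ⬝ᵥ ((Hᵀ * Matrix.diagonal w * H) *ᵥ v) = ∑ q, w q * ((H *ᵥ v) q) ^ 2 := by
  rw [← Matrix.mulVec_mulVec, ← Matrix.mulVec_mulVec, Matrix.dotProduct_mulVec, Matrix.vecMul_transpose]
  simp only [dotProduct, Matrix.mulVec_diagonal]
  exact Finset.sum_congr rfl fun q _ => by ring

/-- **THE EXACT CHART EXPANSION OF THE SCALED ABELIAN BLOCK ACTION** (`V12`'s definition read backwards): along the chart
`θ ↦ θ + g·(H *ᵥ v)`,
`g⁻²·A(ζ, θ + g·Hv) = g⁻²·A(ζ, θ) + g⁻¹·Σ_q ζ_q (Hv)_q sin θ_q + ½·v ⬝ᵥ ((Hᵀ·diag(ζ cos θ)·H) *ᵥ v) + g⁻²·V12 g ζ θ (Hv)` —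
constant + linear (the (1.5) member) + print's quadratic member + the third-order remainder; so the `hexp` binder of this
seat's lineage is DISCHARGED for `φ :=` the genuine action. [cite: Balaban1989LargeFieldII, (1.2) p.357] -/
theorem actionU1_chart_expansion [DecidableEq ι] {g : ℝ} (hg : g ≠ 0) (ζ θ : ι → ℝ) (H : Matrix ι κ ℝ) (v : κ → ℝ) :
    1 / g ^ 2 * actionU1 ζ (fun q => θ q + g * (H *ᵥ v) q) =
      1 / g ^ 2 * actionU1 ζ θ + 1 / g * ∑ q, ζ q * (H *ᵥ v) q * Real.sin (θ q)
        + 1 / 2 * (v ⬝ᵥ ((Hᵀ * Matrix.diagonal (fun q => ζ q * Real.cos (θ q)) * H) *ᵥ v))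
        + 1 / g ^ 2 * V12 g ζ θ (H *ᵥ v) := by
  rw [dotProduct_transpose_diagonal_mulVec]
  unfold V12
  have e : ∑ q, ζ q * Real.cos (θ q) * (H *ᵥ v) q ^ 2 = ∑ q, ζ q * (H *ᵥ v) q ^ 2 * Real.cos (θ q) :=
    Finset.sum_congr rfl fun q _ => by ring
  rw [e]
  field_simp
  ring

/-- the (1.5)-type linear member of the expansion, bundled: `(g⁻¹ • Σ_q (ζ_q sin θ_q) • (proj_q ∘ H))(v) = g⁻¹·Σ_q ζ_q (Hv)_q sin θ_q`.
[textbook] -/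
theorem linMemberU1_apply (g : ℝ) (ζ θ : ι → ℝ) (H : Matrix ι κ ℝ) (v : κ → ℝ) :
    (((1 / g) • ∑ q, (ζ q * Real.sin (θ q)) • ((LinearMap.proj q).comp (Matrix.mulVecLin H))) :
        (κ → ℝ) →ₗ[ℝ] ℝ) v = 1 / g * ∑ q, ζ q * (H *ᵥ v) q * Real.sin (θ q) := by
  simp only [LinearMap.smul_apply, LinearMap.coe_sum, Finset.sum_apply, LinearMap.comp_apply,
    LinearMap.proj_apply, Matrix.mulVecLin_apply, smul_eq_mul]
  congr 1
  exact Finset.sum_congr rfl fun q _ => by ring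

end Algebra

/-! ## §2  ★ The (1.9) binder of the `U(1)` lineage AS A THEOREM in tree gauge (dag-n21-w3 g4's ★ applied) -/

section TreeGauge

variable {d : ℕ}

/-- ★ **(1.9) FOR THE ABELIAN SECOND-ORDER MEMBER IN TREE GAUGE** (dag-n21-w3 g4's ★ `ineq19_of_ineq17_treeGauge` APPLIED
with `C = R_k = ε_k = 0`).  Frame: any real chart `κ` with an extension `E` to 𝔤-valued (`Fin D`) bond configurations on
the cube `Λ = block n y` (`1 ≤ n ≤ 100M`) VANISHING on the comb tree `G₀ = treeBonds n y` and preserving `Σ²`; the chart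
MATRIX `H`, indexed by the inner plaquettes × colours, IS the plaquette curl of the extension (`hcurl`, the located
identification `φ = ∂H_{1,k}B′ ↔ ∂(E v)`); near-flat background letter `γ₀ ≤ ζ_q cos θ_q` (`0 ≤ γ₀`).  Then the (1.7) row
holds with NO correction (`Σ_q ζ_q cos θ_q (Hv)_q² ≥ γ₀·Σ_q (Hv)_q² = γ₀·‖∂(E v)‖²`), (1.8) is the Literature's PROVED cube
theorem, and the ENDs' binder follows: `∀ v, Ineq19 (v ⬝ᵥ ((Hᵀ·diag(ζ cos θ)·H) *ᵥ v)) (Σ_i v_i²) γ₀ d M`.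
[cite: Balaban1989LargeFieldII, (1.7)–(1.9) p.358] -/
theorem ineq19_U1_treeGauge {κ : Type*} [Fintype κ] {n D : ℕ} (M : ℕ) (hd : 1 ≤ d) (hn : 1 ≤ n)
    (hnM : n ≤ 100 * M) (hM : 0 < M) (y : Fin d → ℤ)
    (E : (κ → ℝ) → ((Fin d → ℤ) × Fin d → (Fin D → ℝ)))
    (hEtree : ∀ v, ∀ b ∈ treeBonds n y, E v b = 0)
    (hEsq : ∀ v, ∑ b ∈ innerBonds n y, ∑ a, E v b a ^ 2 = ∑ i, v i ^ 2)
    (H : Matrix (↥(innerPlaq n y) × Fin D) κ ℝ)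
    (hcurl : ∀ v q, (H *ᵥ v) q = curl (fun b => E v b q.2) q.1.1.1 q.1.1.2.1 q.1.1.2.2)
    {ζ θ : ↥(innerPlaq n y) × Fin D → ℝ} {γ₀ : ℝ} (hγ : 0 ≤ γ₀) (hw : ∀ q, γ₀ ≤ ζ q * Real.cos (θ q)) :
    ∀ v, Ineq19 (v ⬝ᵥ ((Hᵀ * Matrix.diagonal (fun q => ζ q * Real.cos (θ q)) * H) *ᵥ v))
      (∑ i, v i ^ 2) γ₀ d M := by
  classical
  refine ineq19_of_ineq17_treeGauge M hd hn hnM hM y E hEtree hEsq _ (C := 0) (Rk := 0) (εk := 0) hγ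
    (fun v => ?_) ?_
  · -- the (1.7) row with NO correction: `γ₀·Σ(∂Ev)² − 0 ≤ Σ ζ cos θ (Hv)²`
    unfold Ineq17
    rw [dotProduct_transpose_diagonal_mulVec, zero_mul, zero_mul, sub_zero]
    have hsum : ∑ p ∈ innerPlaq n y, ∑ a : Fin D, curl (fun b => E v b a) p.1 p.2.1 p.2.2 ^ 2 =
        ∑ q : ↥(innerPlaq n y) × Fin D, (H *ᵥ v) q ^ 2 := by
      rw [Fintype.sum_prod_type, ← Finset.sum_coe_sort (innerPlaq n y)]
      exact Finset.sum_congr rfl fun p _ => Finset.sum_congr rfl fun a _ => by rw [hcurl]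
    rw [hsum, Finset.mul_sum]
    exact Finset.sum_le_sum fun q _ => mul_le_mul_of_nonneg_right (hw q) (sq_nonneg _)
  · -- the smallness line with `C = 0`
    rw [zero_mul]
    have hd0 : (0 : ℝ) < d := by exact_mod_cast hd
    have hM0 : (0 : ℝ) < M := by exact_mod_cast hM
    positivity

/-! ## §3  ★★ ∕ ★★★ Convexity of the abelian (1.2) exponent — and of the block action itself — in tree gauge -/

/-- ★★ **CONVEXITY OF THE ABELIAN (1.2) EXPONENT IN TREE GAUGE, COERCIVITY DISCHARGED**: this seat's p614863 ★★★-loc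
`convexOn_chartExponentU1_analytic_local` with `A := Hᵀ·diag(ζ cos θ)·H` and its binder `h19` SUPPLIED by §2 ★.  Letters
left: the tree-gauge frame (`E`, `hcurl`, `1 ≤ n ≤ 100M`), the near-flat background `γ₀ ≤ ζ_q cos θ_q`, the window
`|(Hv)_q| ≤ Φ`, the row-sum letter `Σ_i |H_{qi}| ≤ c_H`, `Σ_q ζ_q ≤ Z`, and the analytic clause
`4·d·(100M)^{d+1}·S(g, Φ, r) ≤ γ₀·r²` for any `r > 0`. [cite: Balaban1989LargeFieldII, (1.7)–(1.9) p.358] -/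
theorem convexOn_chartExponentU1_treeGauge {κ : Type*} [Fintype κ] {n D : ℕ} (M : ℕ) (hd : 1 ≤ d) (hn : 1 ≤ n)
    (hnM : n ≤ 100 * M) (hM : 0 < M) (y : Fin d → ℤ)
    (E : (κ → ℝ) → ((Fin d → ℤ) × Fin d → (Fin D → ℝ)))
    (hEtree : ∀ v, ∀ b ∈ treeBonds n y, E v b = 0)
    (hEsq : ∀ v, ∑ b ∈ innerBonds n y, ∑ a, E v b a ^ 2 = ∑ i, v i ^ 2)
    (H : Matrix (↥(innerPlaq n y) × Fin D) κ ℝ)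
    (hcurl : ∀ v q, (H *ᵥ v) q = curl (fun b => E v b q.2) q.1.1.1 q.1.1.2.1 q.1.1.2.2)
    {ζ θ : ↥(innerPlaq n y) × Fin D → ℝ} {γ₀ g Φ cH Z r : ℝ} (hγ : 0 ≤ γ₀)
    (hw : ∀ q, γ₀ ≤ ζ q * Real.cos (θ q)) (hg : 0 < g) (hΦ : 0 ≤ Φ) (hcH : 0 ≤ cH) (hζ : ∀ q, 0 ≤ ζ q)
    (hZ : ∑ q, ζ q ≤ Z) (hH : ∀ q, ∑ i, |H q i| ≤ cH) (hr : 0 < r)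
    {K : Set (κ → ℝ)} (hK : Convex ℝ K) (φ : (κ → ℝ) → ℝ) (c : ℝ) (ℓ : (κ → ℝ) →ₗ[ℝ] ℝ)
    (hexp : ∀ v ∈ K, φ v = c + 1 / 2 * (v ⬝ᵥ ((Hᵀ * Matrix.diagonal (fun q => ζ q * Real.cos (θ q)) * H) *ᵥ v))
      + ℓ v + 1 / g ^ 2 * V12 g ζ θ (H *ᵥ v))
    (hwin : ∀ v ∈ K, ∀ q, |(H *ᵥ v) q| ≤ Φ)
    (hclause : 4 * d * (100 * (M : ℝ)) ^ (d + 1) * (g * (Φ + cH * r) ^ 3 * Real.exp (g * (Φ + cH * r)) * Z) ≤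
      γ₀ * r ^ 2) :
    ConvexOn ℝ K φ := by
  classical
  exact convexOn_chartExponentU1_analytic_local hK φ c _ ℓ H θ hg hΦ hcH hζ hZ hH hd (by exact_mod_cast hM) hr hexp
    (ineq19_U1_treeGauge M hd hn hnM hM y E hEtree hEsq H hcurl hγ hw) hwin hclause

/-- ★★★ **THE SCALED ABELIAN BLOCK ACTION ITSELF IS CONVEX ON THE WINDOW, IN TREE GAUGE.**  ★★ with `hexp` ALSO
discharged (§1 `actionU1_chart_expansion`): on a convex window `K` of any tree-gauge chart frame of the cube with
`|(Hv)_q| ≤ Φ`, under the near-flat background letter `γ₀ ≤ ζ_q cos θ_q`, the letters `Σ_i |H_{qi}| ≤ c_H`, `Σ_q ζ_q ≤ Z` and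
the ONE clause `4·d·(100M)^{d+1}·g(Φ + c_H r)³e^{g(Φ + c_H r)}Z ≤ γ₀·r²` (any `r > 0`), the function
`v ↦ g⁻²·A(ζ, θ + g·Hv) = g⁻²·Σ_q ζ_q (1 − cos(θ_q + g(Hv)_q))` is CONVEX on `K` — no expansion, coercivity, second-order
or diameter hypothesis left; «for g_k sufficiently small» is the clause. [cite: Balaban1989LargeFieldII, (1.2)–(1.9) pp.357–358] -/
theorem convexOn_actionU1_treeGaugeChart {κ : Type*} [Fintype κ] {n D : ℕ} (M : ℕ) (hd : 1 ≤ d) (hn : 1 ≤ n)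
    (hnM : n ≤ 100 * M) (hM : 0 < M) (y : Fin d → ℤ)
    (E : (κ → ℝ) → ((Fin d → ℤ) × Fin d → (Fin D → ℝ)))
    (hEtree : ∀ v, ∀ b ∈ treeBonds n y, E v b = 0)
    (hEsq : ∀ v, ∑ b ∈ innerBonds n y, ∑ a, E v b a ^ 2 = ∑ i, v i ^ 2)
    (H : Matrix (↥(innerPlaq n y) × Fin D) κ ℝ)
    (hcurl : ∀ v q, (H *ᵥ v) q = curl (fun b => E v b q.2) q.1.1.1 q.1.1.2.1 q.1.1.2.2)
    {ζ θ : ↥(innerPlaq n y) × Fin D → ℝ} {γ₀ g Φ cH Z r : ℝ} (hγ : 0 ≤ γ₀)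
    (hw : ∀ q, γ₀ ≤ ζ q * Real.cos (θ q)) (hg : 0 < g) (hΦ : 0 ≤ Φ) (hcH : 0 ≤ cH) (hζ : ∀ q, 0 ≤ ζ q)
    (hZ : ∑ q, ζ q ≤ Z) (hH : ∀ q, ∑ i, |H q i| ≤ cH) (hr : 0 < r)
    {K : Set (κ → ℝ)} (hK : Convex ℝ K) (hwin : ∀ v ∈ K, ∀ q, |(H *ᵥ v) q| ≤ Φ)
    (hclause : 4 * d * (100 * (M : ℝ)) ^ (d + 1) * (g * (Φ + cH * r) ^ 3 * Real.exp (g * (Φ + cH * r)) * Z) ≤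
      γ₀ * r ^ 2) :
    ConvexOn ℝ K (fun v => 1 / g ^ 2 * actionU1 ζ (fun q => θ q + g * (H *ᵥ v) q)) := by
  classical
  refine convexOn_chartExponentU1_treeGauge M hd hn hnM hM y E hEtree hEsq H hcurl hγ hw hg hΦ hcH hζ hZ hH hr hK _
    (1 / g ^ 2 * actionU1 ζ θ)
    ((1 / g) • ∑ q, (ζ q * Real.sin (θ q)) • ((LinearMap.proj q).comp (Matrix.mulVecLin H)))
    (fun v _ => ?_) hwin hclause
  rw [linMemberU1_apply, actionU1_chart_expansion hg.ne' ζ θ H v]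
  ring

end TreeGauge

/-! ## §4  A6: the binder list of ★★★ jointly INHABITED on the off-tree chart of a cube — the abelian Wilson action of the
cube in the comb tree gauge is convex on the unit window for an explicit small `g` -/

section Witness

variable {d : ℕ} {n D : ℕ} {y : Fin d → ℤ}

/-- the extension by zero of off-tree chart coordinates is the coordinate sum of the extensions of the basis vectors.
[folklore] -/
theorem extend_eq_sum_basis (v : ↥(innerBonds n y \ treeBonds n y) × Fin D → ℝ) (b : (Fin d → ℤ) × Fin d)
    (a : Fin D) :
    (if h : b ∈ innerBonds n y \ treeBonds n y then v (⟨b, h⟩, a) else (0 : ℝ)) =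
      ∑ i, v i * (if h : b ∈ innerBonds n y \ treeBonds n y then (if (⟨b, h⟩, a) = i then (1 : ℝ) else 0) else 0) := by
  by_cases h : b ∈ innerBonds n y \ treeBonds n y
  · simp only [h, dif_pos, mul_ite, mul_one, mul_zero]
    rw [Finset.sum_ite_eq Finset.univ]
    simp
  · simp [h]

/-- the plaquette curl is linear in the bond configuration (finite sums). [folklore] -/
theorem curl_sum {ι' : Type*} (s : Finset ι') (c : ι' → ℝ) (F : ι' → Cfg d) (z : Fin d → ℤ) (j μ : Fin d) :
    curl (fun b => ∑ i ∈ s, c i * F i b) z j μ = ∑ i ∈ s, c i * curl (F i) z j μ := by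
  simp only [curl, mul_add, mul_sub, Finset.sum_add_distrib, Finset.sum_sub_distrib]

/-- **THE CHART MATRIX OF THE OFF-TREE FRAME IS THE PLAQUETTE CURL OF THE EXTENSION** (`hcurl` PROVED on dag-n21-w3 g4's
§1 frame): with `H_{qi} := (∂ ext(e_i))(q)` (the curl of the extension by zero of the `i`-th basis vector, colour `q.2`),
`(H *ᵥ v)_q = (∂ ext(v)_{q.2})(q.1)` for every chart vector `v`. [folklore] -/
theorem mulVec_curlMatrix (v : ↥(innerBonds n y \ treeBonds n y) × Fin D → ℝ) (q : ↥(innerPlaq n y) × Fin D) :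
    ((Matrix.of fun (q : ↥(innerPlaq n y) × Fin D) (i : ↥(innerBonds n y \ treeBonds n y) × Fin D) =>
        curl (fun b => if h : b ∈ innerBonds n y \ treeBonds n y then (if (⟨b, h⟩, q.2) = i then (1 : ℝ) else 0) else 0)
          q.1.1.1 q.1.1.2.1 q.1.1.2.2) *ᵥ v) q =
      curl (fun b => if h : b ∈ innerBonds n y \ treeBonds n y then v (⟨b, h⟩, q.2) else (0 : ℝ))
        q.1.1.1 q.1.1.2.1 q.1.1.2.2 := by
  have e : (fun b : (Fin d → ℤ) × Fin d => if h : b ∈ innerBonds n y \ treeBonds n y then v (⟨b, h⟩, q.2) else (0 : ℝ)) =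
      fun b => ∑ i, v i *
        (if h : b ∈ innerBonds n y \ treeBonds n y then (if (⟨b, h⟩, q.2) = i then (1 : ℝ) else 0) else 0) :=
    funext fun b => extend_eq_sum_basis v b q.2
  rw [e, curl_sum]
  simp only [Matrix.mulVec, dotProduct, Matrix.of_apply]
  exact Finset.sum_congr rfl fun i _ => mul_comm _ _

/-- four-term bookkeeping: if each bond's indicator family has `Σ_i |F(b)_i| ≤ 1`, the curl family has `Σ_i |(∂F_i)| ≤ 4`.
[folklore] -/
theorem sum_abs_curl_le_four {ι' : Type*} [Fintype ι'] (F : (Fin d → ℤ) × Fin d → ι' → ℝ)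
    (hF : ∀ b, ∑ i, |F b i| ≤ 1) (z : Fin d → ℤ) (j μ : Fin d) :
    ∑ i, |curl (fun b => F b i) z j μ| ≤ 4 := by
  simp only [curl]
  calc ∑ i, |F (z, j) i + F (z + B6BondElimination.unitVec j, μ) i - F (z + B6BondElimination.unitVec μ, j) i
          - F (z, μ) i|
      ≤ ∑ i, (|F (z, j) i| + |F (z + B6BondElimination.unitVec j, μ) i|
          + |F (z + B6BondElimination.unitVec μ, j) i| + |F (z, μ) i|) := by
        refine Finset.sum_le_sum fun i _ => ?_
        linarith [abs_sub (F (z, j) i + F (z + B6BondElimination.unitVec j, μ) i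
            - F (z + B6BondElimination.unitVec μ, j) i) (F (z, μ) i),
          abs_sub (F (z, j) i + F (z + B6BondElimination.unitVec j, μ) i) (F (z + B6BondElimination.unitVec μ, j) i),
          abs_add_le (F (z, j) i) (F (z + B6BondElimination.unitVec j, μ) i)]
    _ = (∑ i, |F (z, j) i|) + (∑ i, |F (z + B6BondElimination.unitVec j, μ) i|)
          + (∑ i, |F (z + B6BondElimination.unitVec μ, j) i|) + ∑ i, |F (z, μ) i| := by
        rw [Finset.sum_add_distrib, Finset.sum_add_distrib, Finset.sum_add_distrib]
    _ ≤ 1 + 1 + 1 + 1 := add_le_add (add_le_add (add_le_add (hF _) (hF _)) (hF _)) (hF _)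
    _ = 4 := by norm_num

/-- **THE ROW-SUM LETTER OF THE CURL MATRIX**: `Σ_i |H_{qi}| ≤ 4` (a plaquette has four bonds; each bond of the block carries
at most one off-tree coordinate per colour). [folklore] -/
theorem rowSum_curlMatrix_le_four (q : ↥(innerPlaq n y) × Fin D) :
    ∑ i : ↥(innerBonds n y \ treeBonds n y) × Fin D,
        |(Matrix.of fun (q : ↥(innerPlaq n y) × Fin D) (i : ↥(innerBonds n y \ treeBonds n y) × Fin D) =>
            curl (fun b => if h : b ∈ innerBonds n y \ treeBonds n y then (if (⟨b, h⟩, q.2) = i then (1 : ℝ) else 0)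
              else 0) q.1.1.1 q.1.1.2.1 q.1.1.2.2) q i| ≤ 4 := by
  simp only [Matrix.of_apply]
  refine sum_abs_curl_le_four
    (fun (b : (Fin d → ℤ) × Fin d) (i : ↥(innerBonds n y \ treeBonds n y) × Fin D) =>
      if h : b ∈ innerBonds n y \ treeBonds n y then (if (⟨b, h⟩, q.2) = i then (1 : ℝ) else 0) else 0)
    (fun b => ?_) _ _ _
  -- one bond: the indicator family sums to at most `1`
  by_cases h : b ∈ innerBonds n y \ treeBonds n y
  · simp only [h, dif_pos]
    rw [Finset.sum_congr rfl fun i _ => abs_of_nonneg (by split_ifs <;> norm_num), Finset.sum_ite_eq Finset.univ]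
    simp
  · simp [h]

/-- **A6 WITNESS OF ★★★** (director-ym STANDING A6 RULE №189 (3)) — EVERY binder DISCHARGED: on the off-tree chart
`κ = ↥(innerBonds n y ∖ treeBonds n y) × Fin 1` of ANY cube `Λ = block n y ⊂ ℤ^d` with `1 ≤ n ≤ 100M` (dag-n21-w3 g4's §1
frame, `U(1)`: one colour), with `E :=` the extension by zero (`extendOffTree_tree`, `sum_sq_extendOffTree`), `H :=` the curl
matrix (`mulVec_curlMatrix`, row-sum letter `≤ 4`), flat background `θ = 0`, weight `ζ = 1` (`γ₀ = 1`, `Z = #(plaquettes)`),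
window `K = B̄₁(0)` (`Φ = 4`), width `r = 1`, and the explicit coupling `g = 1∕(2¹³·d·(100M)^{d+1}·(#plaquettes + 1))`
(clause: `4d(100M)^{d+1}·512·g·e^{8g}·Z ≤ 6144·e^{8g}∕2¹³·1 ≤ ¾e^{8g} < 1`): the scaled abelian Wilson action of the cube
in the comb tree gauge, `v ↦ g⁻²·Σ_q (1 − cos(g·(∂ ext v)(q)))`, is CONVEX on the unit window.  A satisfiability
witness (the U(1) lattice action at an explicit small coupling), not an estimate on Bałaban's measure.
[cite: Balaban1989LargeFieldII, (1.2)–(1.9) pp.357–358] -/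
theorem actionU1_treeGauge_letters_inhabited (M : ℕ) (hd : 1 ≤ d) (hn : 1 ≤ n) (hnM : n ≤ 100 * M) (hM : 0 < M)
    (y : Fin d → ℤ) :
    ∃ g : ℝ, 0 < g ∧
      ConvexOn ℝ (closedBall (0 : ↥(innerBonds n y \ treeBonds n y) × Fin 1 → ℝ) 1)
        (fun v => 1 / g ^ 2 * actionU1 (fun _ : ↥(innerPlaq n y) × Fin 1 => (1 : ℝ))
          (fun q => 0 + g * ((Matrix.of fun (q : ↥(innerPlaq n y) × Fin 1)
              (i : ↥(innerBonds n y \ treeBonds n y) × Fin 1) =>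
              curl (fun b => if h : b ∈ innerBonds n y \ treeBonds n y then (if (⟨b, h⟩, q.2) = i then (1 : ℝ) else 0)
                else 0) q.1.1.1 q.1.1.2.1 q.1.1.2.2) *ᵥ v) q)) := by
  -- the explicit coupling
  obtain ⟨N, hN⟩ : ∃ N : ℝ, N = (Fintype.card (↥(innerPlaq n y) × Fin 1) : ℝ) := ⟨_, rfl⟩
  obtain ⟨P, hP⟩ : ∃ P : ℝ, P = (d : ℝ) * (100 * (M : ℝ)) ^ (d + 1) := ⟨_, rfl⟩
  have hN0 : 0 ≤ N := by rw [hN]; positivity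
  have hd0 : (1 : ℝ) ≤ d := by exact_mod_cast hd
  have hM1 : (1 : ℝ) ≤ M := by exact_mod_cast hM
  have hP1 : 1 ≤ P := by rw [hP]; exact one_le_mul_of_one_le_of_one_le hd0 (one_le_pow₀ (by linarith))
  have hP0 : 0 < P := by linarith
  obtain ⟨g, hg⟩ : ∃ g : ℝ, g = 1 / (2 ^ 13 * P * (N + 1)) := ⟨_, rfl⟩
  have hgpos : 0 < g := by rw [hg]; positivity
  refine ⟨g, hgpos, ?_⟩
  -- the window letter `Φ = 4` on the closed unit ball, from the row-sum letter
  have hwin : ∀ v ∈ closedBall (0 : ↥(innerBonds n y \ treeBonds n y) × Fin 1 → ℝ) 1,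
      ∀ q : ↥(innerPlaq n y) × Fin 1,
        |((Matrix.of fun (q : ↥(innerPlaq n y) × Fin 1) (i : ↥(innerBonds n y \ treeBonds n y) × Fin 1) =>
            curl (fun b => if h : b ∈ innerBonds n y \ treeBonds n y then (if (⟨b, h⟩, q.2) = i then (1 : ℝ) else 0)
              else 0) q.1.1.1 q.1.1.2.1 q.1.1.2.2) *ᵥ v) q| ≤ 4 := by
    intro v hv q
    have hv1 : ‖v‖ ≤ 1 := mem_closedBall_zero_iff.mp hv
    have hrow := rowSum_curlMatrix_le_four (n := n) (y := y) (D := 1) q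
    rw [Matrix.mulVec, dotProduct]
    refine (Finset.abs_sum_le_sum_abs _ _).trans (le_trans (Finset.sum_le_sum fun i _ => ?_) hrow)
    rw [abs_mul]
    have h := norm_le_pi_norm v i
    rw [Real.norm_eq_abs] at h
    calc _ ≤ _ * 1 := mul_le_mul_of_nonneg_left (h.trans hv1) (abs_nonneg _)
      _ = _ := mul_one _
  -- the clause at `g = 1∕(2¹³·P·(N+1))`
  have hclause : 4 * (d : ℝ) * (100 * (M : ℝ)) ^ (d + 1) *
      (g * (4 + 4 * 1) ^ 3 * Real.exp (g * (4 + 4 * 1)) * N) ≤ 1 * 1 ^ 2 := by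
    have hg8 : g * (4 + 4 * 1) ≤ 1 := by
      rw [hg, div_mul_eq_mul_div, one_mul, div_le_one (by positivity)]
      nlinarith
    have hexp3 : Real.exp (g * (4 + 4 * 1)) ≤ 3 :=
      (Real.exp_le_exp.2 hg8).trans (Real.exp_one_lt_d9.le.trans (by norm_num))
    have hkey : P * ((N + 1) * g) = 1 / 2 ^ 13 := by
      rw [hg]
      field_simp
    have hPg : 0 ≤ P * g := by positivity
    calc 4 * (d : ℝ) * (100 * (M : ℝ)) ^ (d + 1) * (g * (4 + 4 * 1) ^ 3 * Real.exp (g * (4 + 4 * 1)) * N)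
        = 2048 * (P * g) * (Real.exp (g * (4 + 4 * 1)) * N) := by rw [hP]; ring
      _ ≤ 2048 * (P * g) * (3 * (N + 1)) := by
          refine mul_le_mul_of_nonneg_left ?_ (by positivity)
          exact mul_le_mul hexp3 (by linarith) hN0 (by norm_num)
      _ = 6144 * (P * ((N + 1) * g)) := by ring
      _ = 6144 * (1 / 2 ^ 13) := by rw [hkey]
      _ ≤ 1 * 1 ^ 2 := by norm_num
  have hZ : ∑ _q : ↥(innerPlaq n y) × Fin 1, (1 : ℝ) ≤ N := by
    rw [hN, Finset.sum_const, Finset.card_univ, nsmul_eq_mul, mul_one]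
  refine convexOn_actionU1_treeGaugeChart (D := 1) M hd hn hnM hM y
    (fun v b a => if h : b ∈ innerBonds n y \ treeBonds n y then v (⟨b, h⟩, a) else (0 : ℝ))
    ?_ ?_
    (Matrix.of fun (q : ↥(innerPlaq n y) × Fin 1) (i : ↥(innerBonds n y \ treeBonds n y) × Fin 1) =>
      curl (fun b => if h : b ∈ innerBonds n y \ treeBonds n y then (if (⟨b, h⟩, q.2) = i then (1 : ℝ) else 0)
        else 0) q.1.1.1 q.1.1.2.1 q.1.1.2.2)
    ?_ (ζ := fun _ => (1 : ℝ)) (θ := fun _ => (0 : ℝ)) (γ₀ := 1) (Φ := 4) (cH := 4) (Z := N) (r := 1) zero_le_one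
    ?_ hgpos (by norm_num) (by norm_num) (fun _ => zero_le_one) hZ ?_ one_pos (convex_closedBall _ _) hwin hclause
  · -- hEtree
    intro v
    exact extendOffTree_tree v
  · -- hEsq
    intro v
    exact sum_sq_extendOffTree v
  · -- hcurl
    intro v q
    exact mulVec_curlMatrix (D := 1) v q
  · -- hw : `1 ≤ 1·cos 0`
    intro q
    simp only [Real.cos_zero, mul_one, le_refl]
  · -- hH : row sums ≤ 4
    intro q
    exact rowSum_curlMatrix_le_four (D := 1) q

end Witness

end Summit.QuantumFields.YangMills.Theorems.N21ChartExponentU1TreeGaugeCoercive
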